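import Summits.QuantumFields.YangMills.Theorems.VirialFluxGapFixSliceDefs
import HarnessLib

/-!
# The Euclidean model `V = ℝ^{18L⁴}` of the slice coordinates on the tree-gauged ring space `X_fix`
# (definitions for layer (B2) of the DIRECT Laplace road to ⟨stmt-QuantumFields-24204⟩ `VirialFluxGap.SharpTwistedLaplace`)

Definitions module (free-hands work of width seat ym-line-sfw-p2-w3 g57, cell ym-idea-1).  The quantitative orbit Laplace theorem
✓`QuantitativeLaplace.laplaceMethod_quantitative_orbit_tube` wants the transversal parametrised by a finite-dimensional real INNER-PRODUCT
space `V` with its canonical volume, whereas the slice coordinates of ✓`VirialFluxGapFixSliceDefs` live in the sup-normed product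
`ℝ³ × RestParam` (`RestParam = (ℝ³)^{off-tree ∖ e₀} × ((ℝ³)^{edges})^{2L−1} × (ℝ³)^{sites ∖ y₀}`).  Here:
* `FixIdx L e₀ y₀` — the structured coordinate index (3 seam∕link coordinates, 3 per remaining component), `fixDim = #FixIdx (= 18L⁴)`,
  `fixIdxEquiv : FixIdx ≃ Fin fixDim` a fixed enumeration (the model is indexed by `Fin fixDim` so that type-class search on `V` stays trivial);
* `fixCoord : EuclideanSpace ℝ (Fin fixDim) → ℝ³ × RestParam` — the block-reading linear coordinate map;
* `restLebesgue` — product Lebesgue measure on `RestParam`; `restWeight b = ∏ expWeight(b_c)` — the product of the exponential-chart Haar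
  densities (✓`T4HaarSU2ExpChart.expWeight = (2π²)⁻¹ sinc²‖·‖`) of the remaining components.
Theorems (injectivity, continuity, block-norm bounds, ★ volume preservation of `fixCoord`, `restParamMeasure = restWeight · restLebesgue` on the
chart domain, and the chart identity on `X_fix` in the literal format of the orbit theorem) are in the sequel `VirialFluxGapFixCoord`.
HONEST FRAMING: definitions only; ⟨24204⟩, ⟨24319⟩ and every rung stay OPEN; the Yang–Mills mass gap (Clay) is NOT touched; no summit is
proved by a line.

## References
* K. W. Breitung, *Asymptotic Approximations for Probability Integrals*, LNM 1592 (1994), §2.3 Definitions 4–5. [Breitung1994]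
* S. Helgason, *Groups and Geometric Analysis* (2000), Ch. I §1 Thm 1.14. [Helgason2000]
-/

set_option autoImplicit false

noncomputable section

open MeasureTheory WithLp
open Literature.MathematicalPhysics.QuantumFieldTheory hiding SU2
open Literature.MathematicalPhysics.QuantumFieldTheory.Balaban1983to89.T4HaarSU2ExpChart
open Summit.QuantumFields.YangMills.Theorems.FemtoTransferGap
open Summit.QuantumFields.YangMills.Theorems.FemtoTransferGap.TT

namespace Summit.QuantumFields.YangMills.Theorems.VirialFluxGap.FixSplit

variable (L : ℕ) [NeZero L] (e₀ : OffIdx L) (y₀ : Site 3 L)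

/-- **Structured index of the slice coordinates**: three seam∕link coordinates, then three per remaining component
(off-tree links other than `e₀`, all links of the `2L−1` free slices, sites other than `y₀`). [cite: Breitung1994, §2.3 Definitions 4–5] -/
abbrev FixIdx : Type :=
  Fin 3 ⊕ (({i : OffIdx L // ¬ i = e₀} × Fin 3) ⊕ (((Fin (2 * L - 1) × Edge 3 L) × Fin 3) ⊕ ({y : Site 3 L // ¬ y = y₀} × Fin 3)))

/-- **The dimension of the slice model** `V` (`= 18L⁴ = dim X_fix − 3`). [cite: Breitung1994, §2.3 Definitions 4–5] -/
def fixDim : ℕ := Fintype.card (FixIdx L e₀ y₀)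

/-- A fixed enumeration of the structured index by `Fin fixDim`. [folklore] -/
def fixIdxEquiv : FixIdx L e₀ y₀ ≃ Fin (fixDim L e₀ y₀) := Fintype.equivFin _

variable {L e₀ y₀}

/-- **THE COORDINATE MAP** `V = ℝ^{fixDim} → ℝ³ × RestParam` reading the blocks of a Euclidean vector: block `inl` is the seam∕link triple
`a = (t, b₁, b₂)`, the other blocks are the exponential coordinates of the remaining components. [cite: Breitung1994, §2.3 Definitions 4–5] -/
def fixCoord (y : EuclideanSpace ℝ (Fin (fixDim L e₀ y₀))) : EuclideanSpace ℝ (Fin 3) × RestParam L e₀ y₀ :=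
  (toLp 2 fun m => y (fixIdxEquiv L e₀ y₀ (Sum.inl m)),
    (fun i => toLp 2 fun m => y (fixIdxEquiv L e₀ y₀ (Sum.inr (Sum.inl (i, m)))),
      (fun j e => toLp 2 fun m => y (fixIdxEquiv L e₀ y₀ (Sum.inr (Sum.inr (Sum.inl ((j, e), m))))),
        fun s => toLp 2 fun m => y (fixIdxEquiv L e₀ y₀ (Sum.inr (Sum.inr (Sum.inr (s, m))))))))

variable (L e₀ y₀) in
/-- **Product Lebesgue measure on `RestParam`** (one copy of `vol_{ℝ³}` per remaining component). [cite: Breitung1994, §2.3 Definitions 4–5] -/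
def restLebesgue : Measure (RestParam L e₀ y₀) :=
  (Measure.pi fun _ : {i : OffIdx L // ¬ i = e₀} => (volume : Measure (EuclideanSpace ℝ (Fin 3)))).prod
    ((Measure.pi fun _ : Fin (2 * L - 1) => Measure.pi fun _ : Edge 3 L => (volume : Measure (EuclideanSpace ℝ (Fin 3)))).prod
      (Measure.pi fun _ : {y : Site 3 L // ¬ y = y₀} => (volume : Measure (EuclideanSpace ℝ (Fin 3)))))

/-- **The rest density** `restWeight b = ∏_c expWeight(b_c)`: the product of the exponential-chart Haar densities `(2π²)⁻¹ sinc²‖b_c‖` of the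
remaining components. [cite: Helgason2000, Ch. I §1 Thm 1.14] -/
def restWeight (b : RestParam L e₀ y₀) : ℝ :=
  (∏ i, expWeight (b.1 i)) * ((∏ j, ∏ e, expWeight (b.2.1 j e)) * ∏ s, expWeight (b.2.2 s))

end Summit.QuantumFields.YangMills.Theorems.VirialFluxGap.FixSplit

end
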